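import Literature.MathematicalPhysics.QuantumFieldTheory.Balaban1983to89.Node00.CarriersB8SubDKappa

/-!
# `Balaban1983to89.B8IdxB8SubDPerUnivFam` — [Balaban1985RegularSpaces] (1.3)–(1.5) p. 77 («we admit the case where some domains Ω_j are equal to T_η»):
# PRINT's TRUNCATED ALL-TORUS TOWER «Ω_j = T_η for j ≤ k» (`B8Eq134Admissible.univFam k`) IS A MEMBER OF EVERY INDEX OF RECORD — the ℤᵈ index `Node00.IdxB8SubD θ`,
# its print-class cut `Node00.IdxB8SubDκ θ M₁ R`, the periodic index `Node00.IdxB8SubDPer θ P` and the κ-cut `Node00.IdxB8SubDPerκ θ P M₁ R` — AT EVERY DEPTH, EVERY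
# PERIOD `P > 0` WITH `Lᵏ ∣ P`, AND FOR EVERY `(M₁, R)`; the rigidity read-out of its constraint towers

statement-level skeleton of published theorems with citation tags; proofs where landed; nothing here is a claim about the Yang–Mills mass gap

T. Bałaban, *Spaces of regular gauge field configurations on a lattice and gauge fixing conditions*, Commun. Math. Phys. **99** (1985) 75–102
`[Balaban1985RegularSpaces]` ("B8"; journal page = PDF page + 74): (1.3)–(1.5) p. 77 («Ω₀ ⊃ Ω₁ ⊃ … ⊃ Ω_k», «Ω_j is a sum of cubes of a size M₁Lʲη,
(Lʲη)⁻¹dist(Ω_jᶜ, Ω_{j+1}) > RM₁», «Let us remark that we admit the case where some domains Ω_j are equal to T_η», «Λ_j = Ω_j^{(j)} ∖ Ω_{j+1}^{(j)}, …, Λ_k = Ω_k^{(k)}»),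
(1.68) p. 88 (the truncated sequences).

## WHY THIS FILE (cell `pub-ymgap`, HUMAN RULING D-0062; seat `pub-ymgap-dag-n16-e` g23, strategy s2 «knit node N16 at the record»; count-neutral; gap (g1) of the seat's
LOCATED note «N16 ∕ N05 record-currency seam», pub-ymgap bus 2026-08-28)

Node N05's witness slot of record is keyed on the print-class PERIODIC cut `Node00.IdxB8SubDPerκ θ P M₁ R = {j : IdxB8SubDPer θ P // Admissible134 θ.L M₁ R k Ω}`
(`Node00/CarriersB8SubDKappa`, director-ym №220 (A-4)).  Its typed inhabitants are print's Sect.-F cube towers (`Node00.exists_idxB8SubDPerκ_depth`, under `1 ≤ M₁`,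
`L ≤ R·M₁`, `M₁·Lᵏ ∣ P`) and `B8Admissible134Periodize`'s genuinely nested member; the UNtruncated all-torus tower «Ω_j = ℤᵈ for ALL j» inhabits the periodic index
(`Node00.exists_idxB8SubDPer_univTower`) but not the cut (it never stops).  The member that node N16 ∕ NE3 reads node N05's Theorem 4 ∕ Proposition 3 at — the WHOLE
TORUS, no boundary, depth `k`, spacing `L⁻ᵏ` — is print's admitted degenerate case «Ω_j = T_η, j ≤ k», typed as `B8Eq134Admissible.univFam k` (`Set.univ` for `j ≤ k`, `∅`
beyond) and proved admissible there for ALL constants (`admissible134_univFam`), but carried by no member of any index so far.  THIS FILE types that member in all four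
indices, with the side facts a reader needs (periodicity of its levels, its (1.3)–(1.4) record `DomainSeq`, its (1.5) level sets `B11Eq7Convention.Lam`), and reads its
constraint towers off by n05-w2's RIGIDITY (`B8IdxB8SubDRigidity.IdxB8SubD.Λs_eq_lam`): `Λs m l = ∅` for `l < m ≤ k` and `Λs m m = ℤᵈ` — node N16's diagonal pin
«`Λs m j = {j = m}`» on every level anything reads.  By-products: the two cuts are non-empty for EVERY `(M₁, R)` and every period with `L ∣ P` (strengthening
`Node00.nonempty_idxB8SubDκ ∕ nonempty_idxB8SubDPerκ`, which ask `1 ≤ M₁`, `L ≤ R·M₁`, `M₁·L ∣ P`).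

## WHAT IS PROVED (kernel, 0 sorry; theorems only, no `def`)

§1 the family `univFam k`: levels (`univFam_of_le ∕ _of_lt ∕ _zero`), periodicity of every level for every period (`isPeriodic_mem_univFam`), the (1.3)–(1.4) record
`domainSeq_univFam`, print's layers and level sets at every truncation `m ≤ k` (`layer_univFam_of_lt ∕ _self`, `lam_univFam_of_lt ∕ _self`).
§2 membership: `exists_idxB8SubD_univFam` (ℤᵈ index; n05-w2's characterisation `exists_idxB8SubD_iff`), `exists_idxB8SubDκ_univFam` (every `(M₁, R)`),
`exists_idxB8SubDPer_univFam` (dag-n05-w2's `exists_idxB8SubDPer_iff`; `0 < P`, `Lᵏ ∣ P`), ★ `exists_idxB8SubDPerκ_univFam` (every `(M₁, R)`).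
§3 non-vacuity for all constants: `nonempty_idxB8SubDκ_all`, `nonempty_idxB8SubDPerκ_of_dvd`.
§4 rigidity read-out at any member whose domains are `univFam k`: `IdxB8SubD.Λs_univFam_of_lt` (`= ∅`), `IdxB8SubD.Λs_univFam_self` (`= Set.univ`), and the same at the κ-cut.

## HONEST SCOPE

Index bookkeeping (membership of one named domain sequence; `simp` ∕ `omega` ∕ characterisations BY NAME); no estimate of [Balaban1985RegularSpaces] is proved or used;
nothing of Bałaban asserted; node N05 ∕ node N16 NOT discharged; counts unmoved; one finite `T⁴` programme at fixed `ε`; nothing continuum ∕ ℝ⁴ ∕ OS ∕ mass-gap ∕ Clay.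
No `sorry`, no `def`, no `instance`, no `notation`.
-/

noncomputable section

namespace Literature.MathematicalPhysics.QuantumFieldTheory.Balaban1983to89.B8IdxB8SubDPerUnivFam


open B8Ineq132 (layer)
open B8ConstraintBonds (DomainSeq)
open B8Eq134Admissible (Admissible134 univFam admissible134_univFam)
open T4TermwiseTorus (IsPeriodic)
open Node00 (Stage3Params IdxB8SubD IdxB8SubDκ IdxB8SubDPer IdxB8SubDPerκ)

variable {d : ℕ}

/-! ## §1 The truncated all-torus tower `univFam k`: levels, periodicity, the (1.3)–(1.4) record, print's layers and level sets -/

/-- The levels `j ≤ k` of the truncated all-torus tower are the whole lattice. [cite: Balaban1985RegularSpaces, p.77 («we admit the case where some domains Ω_j are equal to T_η»)] -/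
theorem univFam_of_le {k j : ℕ} (hj : j ≤ k) : univFam (d := d) k j = Set.univ := by
  simp only [univFam, if_pos hj]

/-- The levels beyond the depth are empty («Ω_j, j = 0, …, k»). [cite: Balaban1985RegularSpaces, (1.3) p.77] -/
theorem univFam_of_lt {k j : ℕ} (hj : k < j) : univFam (d := d) k j = ∅ := by
  simp only [univFam, if_neg (not_le.2 hj)]

/-- `Ω₀ = ℤᵈ` for the truncated all-torus tower. [cite: Balaban1985RegularSpaces, p.77 («Ω₀ = T_η»)] -/
theorem univFam_zero (k : ℕ) : univFam (d := d) k 0 = Set.univ :=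
  univFam_of_le (Nat.zero_le k)

/-- Membership in a level of the truncated all-torus tower is the inequality `j ≤ k`. [cite: Balaban1985RegularSpaces, p.77 (bookkeeping)] -/
theorem mem_univFam_iff {k j : ℕ} (x : Fin d → ℤ) : x ∈ univFam (d := d) k j ↔ j ≤ k := by
  simp only [univFam, Set.mem_ite_empty_right, Set.mem_univ, and_true]

/-- Every level of the truncated all-torus tower is `P`-periodic for every period `P` (it is `ℤᵈ` or `∅`) — print's «Ω_j ⊂ T_η» read on the universal cover.
[cite: Balaban1985RegularSpaces, p.77 («Ω_j ⊂ T_η … we admit Ω_j = T_η»); Balaban1987RG1, (0.1) p.251] -/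
theorem isPeriodic_mem_univFam (P k l : ℕ) : IsPeriodic P (fun x : B7Prop1Explicit.Site d => x ∈ univFam (d := d) k l) := by
  intro x m
  simp only [mem_univFam_iff]

/-- The truncated all-torus tower obeys the (1.3)–(1.4) record `DomainSeq` for every `L` (nesting; block saturation; the one-block collar — all trivial or vacuous).
[cite: Balaban1985RegularSpaces, (1.3)–(1.4) p.77] -/
theorem domainSeq_univFam (L k : ℕ) : DomainSeq L (univFam (d := d) k) where
  anti n x hx := by
    simp only [mem_univFam_iff] at hx ⊢
    omega
  sat n x y _ hx := by
    simp only [mem_univFam_iff] at hx ⊢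
    exact hx
  sep n x t hx _ := by
    simp only [mem_univFam_iff] at hx ⊢
    omega

/-- Print's layer `Bˡ(Λ_l) = Ω_l ∖ Ω_{l+1}` of the truncation at `m ≤ k` is EMPTY below the top (`l < m`): consecutive levels coincide.
[cite: Balaban1985RegularSpaces, (1.5) p.77 («Λ_j = Ω_j^{(j)} ∖ Ω_{j+1}^{(j)}»), (1.68) p.88] -/
theorem layer_univFam_of_lt {k m l : ℕ} (hm : m ≤ k) (hl : l < m) : layer (univFam (d := d) k) m l = ∅ := by
  ext x
  simp only [layer, mem_univFam_iff, Set.mem_setOf_eq, Set.mem_empty_iff_false, iff_false, not_and, not_forall,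
    not_not]
  intro _
  exact ⟨hl, by omega⟩

/-- Print's top layer `Λ_m = Ω_m^{(m)}` of the truncation at `m ≤ k` is the whole lattice. [cite: Balaban1985RegularSpaces, (1.5) p.77 («Λ_k = Ω_k^{(k)}»), (1.68) p.88] -/
theorem layer_univFam_self {k m : ℕ} (hm : m ≤ k) : layer (univFam (d := d) k) m m = Set.univ := by
  ext x
  simp only [layer, mem_univFam_iff, Set.mem_setOf_eq, Set.mem_univ, iff_true]
  exact ⟨hm, fun h => absurd h (lt_irrefl m)⟩

/-- Print's level set `Λ_l` (level-`l` coordinates) of the truncation at `m ≤ k` is EMPTY below the top (`l < m`).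
[cite: Balaban1985RegularSpaces, (1.5) p.77; Balaban1985Variational, (3) p.278] -/
theorem lam_univFam_of_lt (L : ℕ) {k m l : ℕ} (hm : m ≤ k) (hl : l < m) : B11Eq7Convention.Lam L (univFam (d := d) k) m l = ∅ := by
  ext y
  simp only [B11Eq7Convention.Lam, layer_univFam_of_lt hm hl, Set.mem_empty_iff_false, Set.mem_setOf_eq]

/-- Print's top level set `Λ_m` (level-`m` coordinates) of the truncation at `m ≤ k` is ALL level-`m` labels.
[cite: Balaban1985RegularSpaces, (1.5) p.77 («Λ_k = Ω_k^{(k)}»); Balaban1985Variational, (3) p.278] -/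
theorem lam_univFam_self (L : ℕ) {k m : ℕ} (hm : m ≤ k) : B11Eq7Convention.Lam L (univFam (d := d) k) m m = Set.univ := by
  ext y
  simp only [B11Eq7Convention.Lam, layer_univFam_self hm, Set.mem_univ, Set.mem_setOf_eq]

/-! ## §2 Membership in the four indices of record -/

section Membership

variable (θ : Stage3Params)

/-- `0 < L` as a real number (`2 ≤ L`). [folklore] -/
private theorem LposR : 0 < (θ.L : ℝ) := by exact_mod_cast lt_of_lt_of_le (by norm_num) θ.two_le_L

/-- `0 < L` (`2 ≤ L`). [folklore] -/
private theorem Lpos : 0 < θ.L := lt_of_lt_of_le (by norm_num) θ.two_le_L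

/-- ★ **THE TRUNCATED ALL-TORUS TOWER IS A MEMBER OF THE ℤᵈ INDEX OF RECORD `IdxB8SubD θ` AT EVERY DEPTH `k ≥ 1`** (spacing `η = L⁻ᵏ`, domains `univFam k`), by n05-w2's
characterisation `B8IdxB8SubDRigidity.exists_idxB8SubD_iff` (admissible `(η, k, Ω)` ⇒ carried). [cite: Balaban1985RegularSpaces, (1.3)–(1.6) p.77, p.77 («Ω_j = T_η»), (1.68) p.88] -/
theorem exists_idxB8SubD_univFam {k : ℕ} (hk : 1 ≤ k) :
    ∃ j : IdxB8SubD θ, j.1.1.1.1.η = ((θ.L : ℝ) ^ k)⁻¹ ∧ j.1.1.1.1.k = k ∧ j.1.1.1.1.Ω = univFam k := by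
  have hLk : 0 < (θ.L : ℝ) ^ k := pow_pos (LposR θ) k
  refine (B8IdxB8SubDRigidity.exists_idxB8SubD_iff θ _ k _).2 ⟨inv_pos.2 hLk, hk, ?_, univFam_zero k, domainSeq_univFam θ.L k⟩
  rw [mul_inv_cancel₀ hLk.ne']

/-- ★ **… AND OF ITS PRINT-CLASS CUT `IdxB8SubDκ θ M₁ R` FOR EVERY `(M₁, R)`** — (1.3)–(1.4) at `(M₁, R)` hold for the truncated all-torus tower with every clause vacuous or
trivial (`B8Eq134Admissible.admissible134_univFam`). [cite: Balaban1985RegularSpaces, (1.3)–(1.4) p.77 («M₁ … fixed in [4]», «we admit Ω_j = T_η»)] -/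
theorem exists_idxB8SubDκ_univFam (M₁ R : ℕ) {k : ℕ} (hk : 1 ≤ k) :
    ∃ j : IdxB8SubDκ θ M₁ R, j.toZdIdx.η = ((θ.L : ℝ) ^ k)⁻¹ ∧ j.toZdIdx.k = k ∧ j.toZdIdx.Ω = univFam k := by
  obtain ⟨j, hη, hjk, hΩ⟩ := exists_idxB8SubD_univFam θ hk
  have hadm : Admissible134 θ.L M₁ R j.1.1.1.1.k j.1.1.1.1.Ω := by
    rw [hjk, hΩ]; exact admissible134_univFam θ.L M₁ R k
  exact ⟨⟨j, hadm⟩, hη, hjk, hΩ⟩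

/-- ★ **THE TRUNCATED ALL-TORUS TOWER IS A MEMBER OF THE PERIODIC INDEX OF RECORD `IdxB8SubDPer θ P` AT EVERY DEPTH `k ≥ 1` AND EVERY PERIOD `P > 0` WITH `Lᵏ ∣ P`**
(its levels are `ℤᵈ` or `∅`, hence `P`-periodic), by dag-n05-w2's characterisation `Node00.exists_idxB8SubDPer_iff`.  Companion of `Node00.exists_idxB8SubDPer_univTower`
(the UNtruncated tower «Ω_j = ℤᵈ for all j», which never stops and so lies in no κ-cut). [cite: Balaban1985RegularSpaces, p.77 («Ω_j ⊂ T_η … we admit Ω_j = T_η»), (1.3)–(1.5) p.77] -/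
theorem exists_idxB8SubDPer_univFam {P k : ℕ} (hk : 1 ≤ k) (hP : 0 < P) (hdvd : θ.L ^ k ∣ P) :
    ∃ j : IdxB8SubDPer θ P, j.1.1.1.1.1.η = ((θ.L : ℝ) ^ k)⁻¹ ∧ j.1.1.1.1.1.k = k ∧ j.1.1.1.1.1.Ω = univFam k := by
  have hLk : 0 < (θ.L : ℝ) ^ k := pow_pos (LposR θ) k
  refine (Node00.exists_idxB8SubDPer_iff θ _ k _).2
    ⟨⟨inv_pos.2 hLk, hk, ?_, univFam_zero k, domainSeq_univFam θ.L k⟩, ⟨hP, hdvd⟩, fun l => isPeriodic_mem_univFam P k l⟩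
  rw [mul_inv_cancel₀ hLk.ne']

/-- ★★ **THE TRUNCATED ALL-TORUS TOWER IS A MEMBER OF THE κ-CUT `IdxB8SubDPerκ θ P M₁ R` — node N05's witness-slot index of record — AT EVERY DEPTH `k ≥ 1`, EVERY PERIOD
`P > 0` WITH `Lᵏ ∣ P`, AND FOR EVERY `(M₁, R)`** (no `1 ≤ M₁`, no `L ≤ R·M₁`, no `M₁ ∣ P`): the member at which a whole-torus reader (node N16 ∕ NE3) reads Theorem 4 ∕
Proposition 3 of the periodic δ₂-group of record. [cite: Balaban1985RegularSpaces, (1.3)–(1.5) p.77 («we admit the case where some domains Ω_j are equal to T_η»), (1.68) p.88; Balaban1987RG1, (0.1) p.251] -/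
theorem exists_idxB8SubDPerκ_univFam (M₁ R : ℕ) {P k : ℕ} (hk : 1 ≤ k) (hP : 0 < P) (hdvd : θ.L ^ k ∣ P) :
    ∃ j : IdxB8SubDPerκ θ P M₁ R, j.toZdIdx.η = ((θ.L : ℝ) ^ k)⁻¹ ∧ j.toZdIdx.k = k ∧ j.toZdIdx.Ω = univFam k := by
  obtain ⟨j, hη, hjk, hΩ⟩ := exists_idxB8SubDPer_univFam θ hk hP hdvd
  have hadm : Admissible134 θ.L M₁ R j.1.1.1.1.1.k j.1.1.1.1.1.Ω := by
    rw [hjk, hΩ]; exact admissible134_univFam θ.L M₁ R k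
  exact ⟨⟨j, hadm⟩, hη, hjk, hΩ⟩

/-! ## §3 Non-vacuity of the two cuts for ALL constants -/

/-- **THE ℤᵈ CUT IS INHABITED FOR EVERY `(M₁, R)`** (depth 1; strengthens `Node00.nonempty_idxB8SubDκ`, which asks `1 ≤ M₁`, `L ≤ R·M₁`).
[cite: Balaban1985RegularSpaces, (1.3)–(1.4) p.77 («we admit Ω_j = T_η»)] -/
theorem nonempty_idxB8SubDκ_all (M₁ R : ℕ) : Nonempty (IdxB8SubDκ θ M₁ R) :=
  let ⟨j, _⟩ := exists_idxB8SubDκ_univFam θ M₁ R le_rfl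
  ⟨j⟩

/-- **THE κ-CUT IS INHABITED FOR EVERY `(M₁, R)` AND EVERY PERIOD `P > 0` WITH `L ∣ P`** (depth 1; strengthens `Node00.nonempty_idxB8SubDPerκ`, which asks `1 ≤ M₁`,
`L ≤ R·M₁`, `M₁·L ∣ P`): a κ-cut ROW is never vacuous by an empty index. [cite: Balaban1985RegularSpaces, (1.3)–(1.4) p.77, p.77 («Ω_j ⊂ T_η»)] -/
theorem nonempty_idxB8SubDPerκ_of_dvd (M₁ R : ℕ) {P : ℕ} (hP : 0 < P) (hdvd : θ.L ∣ P) : Nonempty (IdxB8SubDPerκ θ P M₁ R) :=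
  let ⟨j, _⟩ := exists_idxB8SubDPerκ_univFam θ M₁ R le_rfl hP (by rwa [pow_one])
  ⟨j⟩

/-- In particular at the period `P = Lᵏ` itself, every depth `k ≥ 1`, every `(M₁, R)`. [cite: Balaban1985RegularSpaces, p.77 (bookkeeping)] -/
theorem nonempty_idxB8SubDPerκ_pow (M₁ R : ℕ) {k : ℕ} (hk : 1 ≤ k) : Nonempty (IdxB8SubDPerκ θ (θ.L ^ k) M₁ R) :=
  let ⟨j, _⟩ := exists_idxB8SubDPerκ_univFam θ M₁ R hk (pow_pos (Lpos θ) k) dvd_rfl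
  ⟨j⟩

end Membership

/-! ## §4 Rigidity read-out: the constraint towers of any member whose domains are the truncated all-torus tower -/

section ReadOut

variable {θ : Stage3Params}

/-- ★ **BELOW THE TOP OF EVERY TRUNCATION THE SITE-LABEL FAMILIES ARE EMPTY**: at a member of the ℤᵈ index with `Ω = univFam k`, `Λs m l = ∅` for `l < m ≤ k` (n05-w2's rigidity
`IdxB8SubD.Λs_eq_lam` + `lam_univFam_of_lt`) — node N16's pin «`Λs m j = {j = m}`» off the diagonal. [cite: Balaban1985RegularSpaces, (1.5) p.77, (1.68) p.88] -/
theorem IdxB8SubD.Λs_univFam_of_lt (j : IdxB8SubD θ) {k : ℕ} (hΩ : j.1.1.1.1.Ω = univFam k) (hjk : j.1.1.1.1.k = k)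
    {m : ℕ} (hm : m ≤ k) {l : ℕ} (hl : l < m) : j.1.1.1.1.Λs m l = ∅ := by
  rw [B8IdxB8SubDRigidity.IdxB8SubD.Λs_eq_lam j (hjk ▸ hm) hl.le, hΩ]
  exact lam_univFam_of_lt θ.L hm hl

/-- ★ **THE TOP FAMILY OF EVERY TRUNCATION IS EVERYTHING**: at a member of the ℤᵈ index with `Ω = univFam k`, `Λs m m = ℤᵈ` for `m ≤ k` — node N16's pin on the diagonal.
[cite: Balaban1985RegularSpaces, (1.5) p.77 («Λ_k = Ω_k^{(k)}»), (1.68) p.88] -/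
theorem IdxB8SubD.Λs_univFam_self (j : IdxB8SubD θ) {k : ℕ} (hΩ : j.1.1.1.1.Ω = univFam k) (hjk : j.1.1.1.1.k = k)
    {m : ℕ} (hm : m ≤ k) : j.1.1.1.1.Λs m m = Set.univ := by
  rw [B8IdxB8SubDRigidity.IdxB8SubD.Λs_eq_lam j (hjk ▸ hm) le_rfl, hΩ]
  exact lam_univFam_self θ.L hm

/-- The same two read-outs at a κ-cut member (node N05's index of record), through `IdxB8SubDPerκ.toZdIdx`. [cite: Balaban1985RegularSpaces, (1.5) p.77, (1.68) p.88] -/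
theorem IdxB8SubDPerκ.Λs_univFam {P M₁ R : ℕ} (j : IdxB8SubDPerκ θ P M₁ R) {k : ℕ} (hΩ : j.toZdIdx.Ω = univFam k) (hjk : j.toZdIdx.k = k)
    {m : ℕ} (hm : m ≤ k) {l : ℕ} (hl : l ≤ m) : j.toZdIdx.Λs m l = if l = m then Set.univ else ∅ := by
  rcases hl.eq_or_lt with rfl | hl'
  · rw [if_pos rfl]; exact IdxB8SubD.Λs_univFam_self j.1.1 hΩ hjk hm
  · rw [if_neg hl'.ne]; exact IdxB8SubD.Λs_univFam_of_lt j.1.1 hΩ hjk hm hl'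

/-- Hence the membership test node N16's pinned sub-family uses, on every level anything reads: `z ∈ Λs m l ↔ l = m` (`l ≤ m ≤ k`).
[cite: Balaban1985RegularSpaces, (1.5) p.77, (1.68) p.88] -/
theorem IdxB8SubDPerκ.mem_Λs_univFam_iff {P M₁ R : ℕ} (j : IdxB8SubDPerκ θ P M₁ R) {k : ℕ} (hΩ : j.toZdIdx.Ω = univFam k) (hjk : j.toZdIdx.k = k)
    {m : ℕ} (hm : m ≤ k) {l : ℕ} (hl : l ≤ m) (z : B7Prop1Explicit.Site θ.D) : z ∈ j.toZdIdx.Λs m l ↔ l = m := by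
  rw [IdxB8SubDPerκ.Λs_univFam j hΩ hjk hm hl]
  split_ifs with h
  · simp only [Set.mem_univ, h]
  · simp only [Set.mem_empty_iff_false, h]

end ReadOut

end Literature.MathematicalPhysics.QuantumFieldTheory.Balaban1983to89.B8IdxB8SubDPerUnivFam

end
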